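import Mathlib
import HarnessLib
import Summits.Ventures.LatticeQCDFlow.StatementTunnelling
import Summits.Ventures.LatticeQCDFlow.Scaling.MonopoleSectors
import Summits.Ventures.LatticeQCDFlow.Scaling.MonopoleCrystalLift
import Summits.Ventures.LatticeQCDFlow.Scaling.MDLeapfrog
import Summits.Ventures.LatticeQCDFlow.Scaling.FluxInsertionLineHeightValueThree
import Summits.Ventures.LatticeQCDFlow.Scaling.MDSpecialUnitaryCollar
import Summits.Ventures.LatticeQCDFlow.Scaling.MDSpecialUnitaryLeapfrog

/-!
# Venture statement — LatticeQCDFlow — DRAFT, Part S9–S12: `ε`-SECTORS IN EVERY DIMENSION (C10),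
# THE HMC TUNNELLING LAWS (`U(1)` FLUX, `SU(N)` SECTORS), AND THE LINE KERNEL AT EVERY VOLUME
# (theory-2 rows 29–30)

HONEST FRAMING: exact (Metropolis-corrected) sampling algorithms for lattice gauge theory;
figures of merit are autocorrelation/cost numbers at stated couplings and volumes; no
continuum-physics claim.

This file CONTINUES `StatementTunnelling.lean` (Part S4–S8) of the venture's `Statement.lean` DRAFT
(review-queued; it STAYS A DRAFT until the operator adopts it).  Every `Prop` is a typed statement
over the landed substrate with its `_holds` discharge next to it, and
`TheoryStatementS12 := TheoryStatementS8 ∧ S9 ∧ S10 ∧ S11 ∧ S12` is PROVED.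

* **S9 (`ε`-SECTORS IN EVERY DIMENSION = LEVEL SETS OF (MONOPOLE NUMBERS, FLUXES); THE MONOPOLE
  THRESHOLD `ε = 1` IS SHARP — THEORY-2 conjecture C10 PROVED, theory2 items 112a–115)** — compact
  `U(1)` on `(ℤ/L)^d`, every `d`, every `L ≥ 1`, `ThinSet d L ε` = every plaquette within chordal
  distance `ε` of `1`: (b) two `ε`-thin configurations with the same DeGrand–Toussaint monopole
  number in every cube and the same Lüscher flux through every coordinate plane through `0` lie in
  one connected component of the thin set, for every `ε` (`MonopoleSectors.MonopoleSectorsC10`);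
  (c) for `ε ≤ 1` (Lüscher admissibility, angles `< π/3`) the `ε`-sectors ARE the flux sectors in
  every dimension (`MonopoleSectors.mem_connectedComponentIn_thin_iff_of_le_one`); (d) the threshold
  `ε = 1` cannot be raised in any `d ≥ 3`: on every even torus and for every `1 < ε ≤ 2` the trivial
  flux sector of the thin set is disconnected (the monopole crystal, `MonopoleSectors.MonopoleThresholdSharp`).
  Over the integer Poincaré lemmas with periods on the discrete torus (`Scaling/TorusCochain`,
  `Scaling/TorusPoincareLemma`).  `d = 2` is S7.
* **S10 (THE HMC FLUX TUNNELLING LAW; THE ENGINE'S `U(1)` LEAPFROG KERNEL IS EXACT AND OBEYS IT —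
  theory2 items 116a–c)** — for every left-invariant s-finite `volU` on `U(1)^E`, every
  translation- and negation-invariant s-finite `volP` on `ℝ^E`, every measurable action `S`, kinetic
  term `T` with `0 < Z_T < ∞`, measurable force `g`, step `δ`, `n` leapfrog steps and every `h : ℝ`,
  the configuration chain "refresh `π ∼ Z_T⁻¹e^{−T}volP`, propose `flip ∘ leapfrog^n`, Metropolis on
  `H = S + T`, forget `π`" (i) leaves `e^{−S}volU` INVARIANT (`Flux.u1_leapfrogHMC_exact`, assembling
  `Exactness.hmc_config_exact` and `Exactness/SplittingIntegrator`) and (ii) changes the flux through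
  any coordinate plane per update at stationarity with probability at most
  `Z_T⁻¹ Σ_{k<3n} (e^{h}·B{z | z.1 ∈ driftCollar (δ/2) (lfField k z)} + B{ΔH_k > h})`,
  `B = e^{−(S+T)}(volU ⊗ volP)` (`Flux.u1_leapfrogHMC_topCharge_ne_le_sum`: the momentum collar and
  the energy-violation tail at each node — two logged run quantities; abstract law
  `Tunnelling.MD.hmc_chargeNe_le_sum`).  Value-free reading: one kernel, two theorems — exact at
  every `(δ, n, β)`, and provably frozen where thick plaquettes and energy violations are rare.

* **S11 (THE LINE KERNEL AT EVERY VOLUME `L ≥ 3` — C9″c beyond its conjectured range, lean-1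
  GEN-7)** — S8 (ii) stated the value of the wrapping-LINE insertion kernel's min–max height and its
  fixed-volume Laplace law for `L ≥ 4` (the range of conjecture C9″c); the one remaining volume with
  a proper wrapping line, `L = 3` (three touched plaquettes, contact angle `π/3`, where the one-sided
  tangent method fails), is proved by the weighted two-sided tangent argument of
  `Scaling/FluxInsertionMountainPassThree`, so `H_line(L) = L(1 − cos(π/L)) + (L² − L)(1 − cos(π/(L² − L)))`
  and the two-sided Laplace law hold for EVERY `L ≥ 3` (`Flux.lineHeight_eq_sharp_of_three_le`,
  `Flux.u1_lineInsertion_fixedVolume_rate_of_three_le`; `H_line(3) = 15/2 − 3√3`,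
  `Flux.lineHeight_three_closedForm`).

* **S12 (THE `SU(N)` HMC SECTOR TUNNELLING LAW — the non-abelian momentum collar, lean-1 GEN-7)** —
  on `SU(N)^E` (Hilbert–Schmidt metric, every `N`, `d`, `L ≥ 1`) the MD drift `U_e ↦ exp(t·ϖ_e)U_e`
  moves each plaquette by at most `|t|·Σ_{e∈∂p}‖ϖ_e‖`, so a drift that changes the connected component
  ("`ε`-sector") of any admissible region `A ⊇ {all plaquettes within ε of 1}` starts with some
  plaquette at distance `≥ ε − |δ|·Σ_{e∈∂p}‖ϖ_e‖` from `1`; hence for the `hmc_config_exact` kernel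
  with such drifts and EVERY measurable observable `Q` constant on the sectors of `A`:
  `(e^{−S}volU ⊗ K){Q ≠ Q'} ≤ Z_T⁻¹ Σ_{k<n} (e^{h}·B{SU(N) momentum collar at node k} + B{ΔH_k > h})`
  (`SUN.sun_hmc_sectorCharge_ne_le_sum`, over theory2's abstract law `Tunnelling.MD.hmc_chargeNe_le_sum`).

NOT part of the binding text: the collar masses and `ΔH` tails (inputs, not certified); odd `L` in
S9 (d); an `SU(N)` leapfrog instance of S12 (only the abstract drift schedule is typed); the line
kernel at `L = 2`; any mixing-time, cost or ranking statement.
-/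

noncomputable section

namespace Summit.Ventures.LatticeQCDFlow

open MeasureTheory ProbabilityTheory
open scoped ENNReal Matrix.Norms.Frobenius
open Literature.MathematicalPhysics.QuantumFieldTheory Literature.MathematicalPhysics.QuantumLattice
open Summit.Ventures.LatticeQCDFlow.Theory2
open Summit.Ventures.LatticeQCDFlow.Theory2.Tunnelling
open Summit.Ventures.LatticeQCDFlow.Theory2.Lattice.Flux

/-! ### Part S, continued — sectors in every dimension, and the HMC law -/

/-- **S9 (`ε`-SECTORS IN EVERY DIMENSION; THE MONOPOLE THRESHOLD IS SHARP — C10).**  (b) For every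
`d`, every `L ≥ 1` and every `ε` (stated for `0 < ε < 2`), two `ε`-thin `U(1)` configurations on
`(ℤ/L)^d` with equal monopole numbers in every cube and equal fluxes `topCharge 0 μ ν` (`μ < ν`)
lie in the same connected component of `ThinSet d L ε` (`MonopoleSectors.MonopoleSectorsC10 d L`);
(c) for `ε ≤ 1` two `ε`-thin configurations lie in one component IFF their fluxes agree — the
`ε`-sectors are exactly the flux sectors, in every dimension; (d) in every `d ≥ 3`, on every even
torus and for every `1 < ε ≤ 2`, the thin set contains a configuration with all fluxes zero outside
the `ε`-sector of the vacuum (`MonopoleSectors.MonopoleThresholdSharp`).  PROVED: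
`MonopoleSectors.monopoleSectorsC10`, `MonopoleSectors.mem_connectedComponentIn_thin_iff_of_le_one`,
`MonopoleSectors.monopoleThresholdSharp` (`Scaling/MonopoleSectors.lean`,
`Scaling/MonopoleCrystalLift.lean`, theory2 items 113b / 115, custody lean-1 GEN-7). -/
def S9_MonopoleSectors : Prop :=
  (∀ (d L : ℕ) [NeZero L], MonopoleSectors.MonopoleSectorsC10 d L) ∧
  (∀ (d L : ℕ) [NeZero L] (ε : ℝ), ε ≤ 1 → ∀ U U' : GaugeConfig d L Circle,
    U ∈ MonopoleSectors.ThinSet d L ε → U' ∈ MonopoleSectors.ThinSet d L ε →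
    (U' ∈ connectedComponentIn (MonopoleSectors.ThinSet d L ε) U ↔
      ∀ μ ν : Fin d, μ < ν → topCharge (0 : Site d L) μ ν U' = topCharge (0 : Site d L) μ ν U)) ∧
  MonopoleSectors.MonopoleThresholdSharp

/-- S9 holds (`monopoleSectorsC10`, `mem_connectedComponentIn_thin_iff_of_le_one`,
`monopoleThresholdSharp`). -/
theorem S9_MonopoleSectors_holds : S9_MonopoleSectors :=
  ⟨fun d L _ => MonopoleSectors.monopoleSectorsC10 d L,
    fun _ _ _ _ hε _ _ hU hU' => MonopoleSectors.mem_connectedComponentIn_thin_iff_of_le_one hε hU hU',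
    MonopoleSectors.monopoleThresholdSharp⟩

/-- **S10 (THE HMC FLUX TUNNELLING LAW; THE ENGINE'S `U(1)` LEAPFROG KERNEL IS EXACT AND OBEYS IT).**
For every `d`, `L ≥ 1`, every left-invariant s-finite `volU` on `U(1)^E` and translation- and
negation-invariant s-finite `volP` on `ℝ^E`, every measurable `S`, `T` with
`0 < ∫ e^{−T} dvolP < ∞`, every measurable force `g`, step `δ` and `n`: the kernel
`K = refreshUpdate (involMH (flip ∘ leapfrog (mulDrift (halfExp δ)) g ^ n) (S + T)) (Z_T⁻¹e^{−T}volP)`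
of `Exactness/MomentumRefresh` + `Exactness/SplittingIntegrator` (i) leaves `e^{−S}volU` invariant
and (ii) for every base point, plane and `h : ℝ`, satisfies
`(e^{−S}volU ⊗ K){Q ≠ Q'} ≤ Z_T⁻¹ Σ_{k<3n} (e^{h}·B{z | z.1 ∈ driftCollar (δ/2) (lfField k z)} + B{ΔH_k > h})`
with `B = e^{−(S+T)}(volU ⊗ volP)` and `ΔH_k` the energy violation at leapfrog node `k`.  PROVED:
`Flux.u1_leapfrogHMC_exact`, `Flux.u1_leapfrogHMC_topCharge_ne_le_sum` (`Scaling/MDLeapfrog.lean`,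
theory2 item 116c over 116a `Tunnelling.MD.hmc_chargeNe_le_sum` and 116b; custody lean-1 GEN-7). -/
def S10_LeapfrogHMCExactAndFrozen : Prop :=
  ∀ (d L : ℕ) [NeZero L] (volU : Measure (GaugeConfig d L Circle)) [SFinite volU]
    [volU.IsMulLeftInvariant] (volP : Measure (Edge d L → ℝ)) [SFinite volP]
    [volP.IsAddRightInvariant] [volP.IsNegInvariant]
    (S : GaugeConfig d L Circle → ℝ) (hS : Measurable S) (T : (Edge d L → ℝ) → ℝ) (hT : Measurable T)
    (δ : ℝ) (g : GaugeConfig d L Circle → (Edge d L → ℝ)) (hg : Measurable g) (n : ℕ),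
    volP.withDensity (fun π => ENNReal.ofReal (Real.exp (-T π))) Set.univ ≠ 0 →
    volP.withDensity (fun π => ENNReal.ofReal (Real.exp (-T π))) Set.univ ≠ ∞ →
    Kernel.Invariant
      (Exactness.refreshUpdate
        (Exactness.involMH
          (⇑((Exactness.flip : Equiv.Perm (GaugeConfig d L Circle × (Edge d L → ℝ))) *
              Exactness.leapfrog (Exactness.mulDrift (halfExp δ)) g ^ n))
          (Exactness.measurable_flip_leapfrog_pow
            (Exactness.measurable_mulDrift (measurable_halfExp δ)) hg n)
          fun z : GaugeConfig d L Circle × (Edge d L → ℝ) => S z.1 + T z.2)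
        ((volP.withDensity (fun π => ENNReal.ofReal (Real.exp (-T π))) Set.univ)⁻¹ •
          volP.withDensity fun π => ENNReal.ofReal (Real.exp (-T π))))
      (MD.boltz volU S) ∧
    ∀ (x₀ : Site d L) (μ ν : Fin d) (h : ℝ),
      (MD.boltz volU S ⊗ₘ
          Exactness.refreshUpdate
            (Exactness.involMH
              (⇑((Exactness.flip : Equiv.Perm (GaugeConfig d L Circle × (Edge d L → ℝ))) *
                Exactness.leapfrog (Exactness.mulDrift (halfExp δ)) g ^ n))
              (Exactness.measurable_flip_leapfrog_pow
                (Exactness.measurable_mulDrift (measurable_halfExp δ)) hg n)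
              fun z : GaugeConfig d L Circle × (Edge d L → ℝ) => S z.1 + T z.2)
            ((volP.withDensity (fun π => ENNReal.ofReal (Real.exp (-T π))) Set.univ)⁻¹ •
              volP.withDensity fun π => ENNReal.ofReal (Real.exp (-T π))))
        {q | topCharge x₀ μ ν q.1 ≠ topCharge x₀ μ ν q.2} ≤
        (volP.withDensity (fun π => ENNReal.ofReal (Real.exp (-T π))) Set.univ)⁻¹ *
          ∑ k ∈ Finset.range (3 * n),
            (ENNReal.ofReal (Real.exp h) *
                MD.boltz (volU.prod volP) (fun z => S z.1 + T z.2)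
                  {z | z.1 ∈ driftCollar x₀ μ ν (δ / 2) (lfField k z)} +
              MD.boltz (volU.prod volP) (fun z => S z.1 + T z.2)
                {z | h < (S (MD.nodes (MD.lfStep (Exactness.mulDrift (halfExp δ)) g) k z).1 +
                    T (MD.nodes (MD.lfStep (Exactness.mulDrift (halfExp δ)) g) k z).2) -
                  (S z.1 + T z.2)})

/-- S10 holds (`Flux.u1_leapfrogHMC_exact`, `Flux.u1_leapfrogHMC_topCharge_ne_le_sum`). -/
theorem S10_LeapfrogHMCExactAndFrozen_holds : S10_LeapfrogHMCExactAndFrozen :=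
  fun _ _ _ volU _ _ volP _ _ _ _ hS _ hT δ _ hg n hZ0 hZtop =>
    ⟨u1_leapfrogHMC_exact volU volP hS hT δ hg n hZ0 hZtop,
      fun x₀ μ ν h => u1_leapfrogHMC_topCharge_ne_le_sum x₀ μ ν volU volP hS hT δ hg n hZ0 hZtop h⟩

/-- **S11 (THE LINE KERNEL'S SHARP FIXED-VOLUME RATE AT EVERY VOLUME `L ≥ 3`).**  On the 2-d
`U(1)` torus `(ℤ/L)²`, for every `L ≥ 3`: the wrapping-LINE insertion kernel's essential min–max
height is `(insHeight₂ (sliceTwist L) 0 0 1).toReal = L(1 − cos(π/L)) + (L² − L)(1 − cos(π/(L² − L)))`,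
and for every `ε > 0`, eventually in `β`,
`e^{−β(E*_line + ε)} ≤ (μ_β ⊗ K_line){Q ≠ Q'} ≤ e^{−β(E*_line − ε)}` with that exponent (S8 (ii) had
`L ≥ 4`).  PROVED: `Flux.lineHeight_eq_sharp_of_three_le`,
`Flux.u1_lineInsertion_fixedVolume_rate_of_three_le` (`Scaling/FluxInsertionLineHeightValueThree.lean`,
over `Scaling/FluxInsertionMountainPassThree.lean`; lean-1 GEN-7). -/
def S11_LineKernelEveryVolume : Prop :=
  ∀ (L : ℕ) [NeZero L], 3 ≤ L →
    (insHeight₂ (sliceTwist L) (0 : Site 2 L) 0 1).toReal =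
      (L : ℝ) * (1 - Real.cos (Real.pi / L)) +
        ((L : ℝ) ^ 2 - L) * (1 - Real.cos (Real.pi / ((L : ℝ) ^ 2 - L))) ∧
    ∀ ε : ℝ, 0 < ε → ∀ᶠ β : ℝ in Filter.atTop,
      Real.exp (-(β * ((L : ℝ) * (1 - Real.cos (Real.pi / L)) +
          ((L : ℝ) ^ 2 - L) * (1 - Real.cos (Real.pi / ((L : ℝ) ^ 2 - L))) + ε))) ≤
        ((wilsonMeasure (d := 2) (L := L) u1Rep β) ⊗ₘ lineInsertionMH (L := L) β).real
          {q | topCharge (0 : Site 2 L) 0 1 q.1 ≠ topCharge (0 : Site 2 L) 0 1 q.2} ∧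
      ((wilsonMeasure (d := 2) (L := L) u1Rep β) ⊗ₘ lineInsertionMH (L := L) β).real
          {q | topCharge (0 : Site 2 L) 0 1 q.1 ≠ topCharge (0 : Site 2 L) 0 1 q.2} ≤
        Real.exp (-(β * ((L : ℝ) * (1 - Real.cos (Real.pi / L)) +
          ((L : ℝ) ^ 2 - L) * (1 - Real.cos (Real.pi / ((L : ℝ) ^ 2 - L))) - ε)))

/-- S11 holds (`Flux.lineHeight_eq_sharp_of_three_le`, `Flux.u1_lineInsertion_fixedVolume_rate_of_three_le`). -/
theorem S11_LineKernelEveryVolume_holds : S11_LineKernelEveryVolume :=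
  fun _ _ hL => ⟨lineHeight_eq_sharp_of_three_le hL,
    fun _ hε => u1_lineInsertion_fixedVolume_rate_of_three_le hL hε⟩

/-- **S12 (THE `SU(N)` HMC SECTOR TUNNELLING LAW).**  For every `N`, `d`, `L ≥ 1`, every admissible
region `A ⊆ SU(N)^E` containing all configurations whose plaquettes are within Hilbert–Schmidt
distance `ε` of `1`, every measurable `Q` constant on the connected components of `A`, every
s-finite `volU`, `volP`, measurable `S`, `T` with `0 < ∫e^{−T}dvolP < ∞`, every schedule of
`volU ⊗ volP`-preserving phase-space steps whose configuration component is the `SU(N)` MD drift by a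
measurable momentum field `g k` for time `δ k`, `flip` fixing configurations, proposal
`Φ = flip ∘ nodes step n`, and every `h : ℝ`:
`(e^{−S}volU ⊗ K){Q ≠ Q'} ≤ Z_T⁻¹ Σ_{k<n} (e^{h}·B{z | ∃ p, ε − |δ_k|·Σ_{e∈∂p}‖(g_k z)_e‖ ≤ dist((z.1)_p, 1)} + B{ΔH_k > h})`,
`K` the kernel of `Exactness.hmc_config_exact`, `B = e^{−(S+T)}(volU ⊗ volP)`.  PROVED:
`Theory2.Lattice.SUN.sun_hmc_sectorCharge_ne_le_sum` (`Scaling/MDSpecialUnitaryCollar.lean`, lean-1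
GEN-7; the `U(1)` flux version is S10). -/
def S12_SUNHMCSectorTunnellingLaw : Prop :=
  ∀ (N d L : ℕ) [NeZero L] (ε : ℝ) (A : Set (GaugeConfig d L (Matrix.specialUnitaryGroup (Fin N) ℂ))),
    (∀ V : GaugeConfig d L (Matrix.specialUnitaryGroup (Fin N) ℂ),
      (∀ x μ ν, dist (plaquetteHolonomy V x μ ν) 1 < ε) → V ∈ A) →
    ∀ (Q : GaugeConfig d L (Matrix.specialUnitaryGroup (Fin N) ℂ) → ℝ), Measurable Q →
    (∀ U V : GaugeConfig d L (Matrix.specialUnitaryGroup (Fin N) ℂ),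
      V ∈ connectedComponentIn A U → Q V = Q U) →
    ∀ (M : Type) [MeasurableSpace M]
      (volU : Measure (GaugeConfig d L (Matrix.specialUnitaryGroup (Fin N) ℂ))) (volP : Measure M)
      [SFinite volU] [SFinite volP]
      (S : GaugeConfig d L (Matrix.specialUnitaryGroup (Fin N) ℂ) → ℝ) (_ : Measurable S)
      (T : M → ℝ) (_ : Measurable T)
      (step : ℕ → GaugeConfig d L (Matrix.specialUnitaryGroup (Fin N) ℂ) × M →
        GaugeConfig d L (Matrix.specialUnitaryGroup (Fin N) ℂ) × M),
      (∀ k, MeasurePreserving (step k) (volU.prod volP) (volU.prod volP)) →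
    ∀ (δ : ℕ → ℝ)
      (g : ℕ → GaugeConfig d L (Matrix.specialUnitaryGroup (Fin N) ℂ) × M → (Edge d L → Lattice.SUN.suAlg N)),
      (∀ k, Measurable (g k)) → (∀ k z, (step k z).1 = Lattice.SUN.drift (δ k) (g k z) z.1) →
    ∀ (flip : GaugeConfig d L (Matrix.specialUnitaryGroup (Fin N) ℂ) × M →
        GaugeConfig d L (Matrix.specialUnitaryGroup (Fin N) ℂ) × M), (∀ z, (flip z).1 = z.1) →
    ∀ (n : ℕ) (Φ : GaugeConfig d L (Matrix.specialUnitaryGroup (Fin N) ℂ) × M →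
        GaugeConfig d L (Matrix.specialUnitaryGroup (Fin N) ℂ) × M) (hΦ : Measurable Φ),
      (∀ z, Φ z = flip (MD.nodes step n z)) →
      volP.withDensity (fun π => ENNReal.ofReal (Real.exp (-T π))) Set.univ ≠ 0 →
      volP.withDensity (fun π => ENNReal.ofReal (Real.exp (-T π))) Set.univ ≠ ∞ →
    ∀ h : ℝ,
      (MD.boltz volU S ⊗ₘ
          Exactness.refreshUpdate (Exactness.involMH Φ hΦ fun z => S z.1 + T z.2)
            ((volP.withDensity (fun π => ENNReal.ofReal (Real.exp (-T π))) Set.univ)⁻¹ •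
              volP.withDensity fun π => ENNReal.ofReal (Real.exp (-T π))))
        {q | Q q.1 ≠ Q q.2} ≤
        (volP.withDensity (fun π => ENNReal.ofReal (Real.exp (-T π))) Set.univ)⁻¹ *
          ∑ k ∈ Finset.range n,
            (ENNReal.ofReal (Real.exp h) *
                MD.boltz (volU.prod volP) (fun z => S z.1 + T z.2)
                  {z | ∃ (x : Site d L) (μ ν : Fin d),
                    ε - |δ k| * (‖g k z (x, μ)‖ + ‖g k z (x.shift μ, ν)‖ + ‖g k z (x.shift ν, μ)‖ +
                      ‖g k z (x, ν)‖) ≤ dist (plaquetteHolonomy z.1 x μ ν) 1} +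
              MD.boltz (volU.prod volP) (fun z => S z.1 + T z.2)
                {z | h < (S (MD.nodes step k z).1 + T (MD.nodes step k z).2) - (S z.1 + T z.2)})

/-- S12 holds (`SUN.sun_hmc_sectorCharge_ne_le_sum`). -/
theorem S12_SUNHMCSectorTunnellingLaw_holds : S12_SUNHMCSectorTunnellingLaw :=
  fun _ _ _ _ _ _ hA _ hQ hQA _ _ volU volP _ _ _ hS _ hT _ hstep δ _ hg hdrift _ hflip n _ hΦ hΦeq
      hZ0 hZtop h =>
    Lattice.SUN.sun_hmc_sectorCharge_ne_le_sum hA hQ hQA volU volP hS hT hstep δ hg hdrift hflip n hΦ hΦeq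
      hZ0 hZtop h

/-- **The theory conjunction of record, extended through C10, the HMC laws and the line kernel at
every volume**: `TheoryStatementS12 := TheoryStatementS8 ∧ S9 ∧ S10 ∧ S11 ∧ S12`.  All conjuncts
are theorems in the tree (`TheoryStatementS12_holds`).  DRAFT until the operator adopts it;
nothing numerical is asserted. -/
def TheoryStatementS12 : Prop :=
  TheoryStatementS8 ∧ S9_MonopoleSectors ∧ S10_LeapfrogHMCExactAndFrozen ∧ S11_LineKernelEveryVolume ∧
    S12_SUNHMCSectorTunnellingLaw

/-- The extended theory conjunction holds. -/
theorem TheoryStatementS12_holds : TheoryStatementS12 :=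
  ⟨TheoryStatementS8_holds, S9_MonopoleSectors_holds, S10_LeapfrogHMCExactAndFrozen_holds,
    S11_LineKernelEveryVolume_holds, S12_SUNHMCSectorTunnellingLaw_holds⟩

/-! ### Part S, appended — S13: the `SU(N)` leapfrog instance of S12 (lean-1 GEN-7, 2026-08-22) -/

/-- **S13 (THE ENGINE-SHAPED `SU(N)` GAUGE LEAPFROG HMC KERNEL IS EXACT AND OBEYS THE SECTOR
TUNNELLING LAW — the `SU(N)` twin of S10, discharging S12's "no leapfrog instance" caveat).**  For
every `N`, `d`, `L ≥ 1`, left-invariant s-finite `volU` on `SU(N)^E`, translation- and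
negation-invariant s-finite `volP` on `𝔰𝔲(N)^E`, measurable `S`, `T` with `0 < ∫e^{−T}dvolP < ∞`,
measurable force `g`, step `δ` and `n`: the configuration chain "refresh `π`, propose
`flip ∘ leapfrog (mulDrift (SUN.halfExp δ)) g ^ n` (links drift by `U_e ↦ exp((δ/2)π_e)U_e`),
Metropolis on `S + T`, forget `π`" (i) leaves `e^{−S}volU` invariant, and (ii) for every admissible
region `A ⊇ {all plaquettes within ε of 1}`, every measurable `Q` constant on the connected
components of `A` and every `h : ℝ`, changes `Q` per update at stationarity with probability at most
`Z_T⁻¹ Σ_{k<3n} (e^{h}·B{z | ∃ p, ε − |δ/2|·Σ_{e∈∂p}‖(lfField k z)_e‖ ≤ dist((z.1)_p, 1)} + B{ΔH_k > h})`.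
PROVED: `Theory2.Lattice.SUN.sun_leapfrogHMC_exact`, `SUN.sun_leapfrogHMC_sectorCharge_ne_le_sum`
(`Scaling/MDSpecialUnitaryLeapfrog.lean`, lean-1 GEN-7). -/
def S13_SUNLeapfrogHMCExactAndSectorLaw : Prop :=
  ∀ (N d L : ℕ) [NeZero L]
    (volU : Measure (GaugeConfig d L (Matrix.specialUnitaryGroup (Fin N) ℂ))) [SFinite volU]
    [volU.IsMulLeftInvariant] (volP : Measure (Edge d L → Lattice.SUN.suAlg N)) [SFinite volP]
    [volP.IsAddRightInvariant] [volP.IsNegInvariant]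
    (S : GaugeConfig d L (Matrix.specialUnitaryGroup (Fin N) ℂ) → ℝ) (hS : Measurable S)
    (T : (Edge d L → Lattice.SUN.suAlg N) → ℝ) (hT : Measurable T) (δ : ℝ)
    (g : GaugeConfig d L (Matrix.specialUnitaryGroup (Fin N) ℂ) → (Edge d L → Lattice.SUN.suAlg N))
    (hg : Measurable g) (n : ℕ),
    volP.withDensity (fun π => ENNReal.ofReal (Real.exp (-T π))) Set.univ ≠ 0 →
    volP.withDensity (fun π => ENNReal.ofReal (Real.exp (-T π))) Set.univ ≠ ∞ →
    Kernel.Invariant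
      (Exactness.refreshUpdate
        (Exactness.involMH
          (⇑((Exactness.flip : Equiv.Perm (GaugeConfig d L (Matrix.specialUnitaryGroup (Fin N) ℂ) ×
              (Edge d L → Lattice.SUN.suAlg N))) *
            Exactness.leapfrog (Exactness.mulDrift (Lattice.SUN.halfExp δ)) g ^ n))
          (Exactness.measurable_flip_leapfrog_pow
            (Exactness.measurable_mulDrift (Lattice.SUN.measurable_halfExp δ)) hg n)
          fun z => S z.1 + T z.2)
        ((volP.withDensity (fun π => ENNReal.ofReal (Real.exp (-T π))) Set.univ)⁻¹ •
          volP.withDensity fun π => ENNReal.ofReal (Real.exp (-T π))))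
      (MD.boltz volU S) ∧
    ∀ (ε : ℝ) (A : Set (GaugeConfig d L (Matrix.specialUnitaryGroup (Fin N) ℂ))),
      (∀ V : GaugeConfig d L (Matrix.specialUnitaryGroup (Fin N) ℂ),
        (∀ x μ ν, dist (plaquetteHolonomy V x μ ν) 1 < ε) → V ∈ A) →
      ∀ (Q : GaugeConfig d L (Matrix.specialUnitaryGroup (Fin N) ℂ) → ℝ), Measurable Q →
      (∀ U V : GaugeConfig d L (Matrix.specialUnitaryGroup (Fin N) ℂ),
        V ∈ connectedComponentIn A U → Q V = Q U) →
      ∀ h : ℝ,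
        (MD.boltz volU S ⊗ₘ
            Exactness.refreshUpdate
              (Exactness.involMH
                (⇑((Exactness.flip : Equiv.Perm (GaugeConfig d L (Matrix.specialUnitaryGroup (Fin N) ℂ) ×
                    (Edge d L → Lattice.SUN.suAlg N))) *
                  Exactness.leapfrog (Exactness.mulDrift (Lattice.SUN.halfExp δ)) g ^ n))
                (Exactness.measurable_flip_leapfrog_pow
                  (Exactness.measurable_mulDrift (Lattice.SUN.measurable_halfExp δ)) hg n)
                fun z => S z.1 + T z.2)
              ((volP.withDensity (fun π => ENNReal.ofReal (Real.exp (-T π))) Set.univ)⁻¹ •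
                volP.withDensity fun π => ENNReal.ofReal (Real.exp (-T π))))
          {q | Q q.1 ≠ Q q.2} ≤
          (volP.withDensity (fun π => ENNReal.ofReal (Real.exp (-T π))) Set.univ)⁻¹ *
            ∑ k ∈ Finset.range (3 * n),
              (ENNReal.ofReal (Real.exp h) *
                  MD.boltz (volU.prod volP) (fun z => S z.1 + T z.2)
                    {z | ∃ (x : Site d L) (μ ν : Fin d),
                      ε - |δ / 2| * (‖Lattice.SUN.lfField k z (x, μ)‖ +
                        ‖Lattice.SUN.lfField k z (x.shift μ, ν)‖ +
                        ‖Lattice.SUN.lfField k z (x.shift ν, μ)‖ + ‖Lattice.SUN.lfField k z (x, ν)‖) ≤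
                          dist (plaquetteHolonomy z.1 x μ ν) 1} +
                MD.boltz (volU.prod volP) (fun z => S z.1 + T z.2)
                  {z | h < (S (MD.nodes (MD.lfStep (Exactness.mulDrift (Lattice.SUN.halfExp δ)) g) k z).1 +
                      T (MD.nodes (MD.lfStep (Exactness.mulDrift (Lattice.SUN.halfExp δ)) g) k z).2) -
                    (S z.1 + T z.2)})

/-- S13 holds (`SUN.sun_leapfrogHMC_exact`, `SUN.sun_leapfrogHMC_sectorCharge_ne_le_sum`). -/
theorem S13_SUNLeapfrogHMCExactAndSectorLaw_holds : S13_SUNLeapfrogHMCExactAndSectorLaw :=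
  fun _ _ _ _ volU _ _ volP _ _ _ _ hS _ hT δ _ hg n hZ0 hZtop =>
    ⟨Lattice.SUN.sun_leapfrogHMC_exact volU volP hS hT δ hg n hZ0 hZtop,
      fun _ _ hA _ hQ hQA h =>
        Lattice.SUN.sun_leapfrogHMC_sectorCharge_ne_le_sum hA hQ hQA volU volP hS hT δ hg n
          hZ0 hZtop h⟩

/-- **The theory conjunction of record, extended by the `SU(N)` leapfrog instance**:
`TheoryStatementS13 := TheoryStatementS12 ∧ S13`.  All conjuncts are theorems in the tree
(`TheoryStatementS13_holds`).  DRAFT until the operator adopts it; nothing numerical is asserted. -/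
def TheoryStatementS13 : Prop :=
  TheoryStatementS12 ∧ S13_SUNLeapfrogHMCExactAndSectorLaw

/-- The extended theory conjunction holds. -/
theorem TheoryStatementS13_holds : TheoryStatementS13 :=
  ⟨TheoryStatementS12_holds, S13_SUNLeapfrogHMCExactAndSectorLaw_holds⟩

end Summit.Ventures.LatticeQCDFlow

end
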